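import Summits.CriticalPhenomena.PercolationContinuityZ3.Theorems.Transplant.SkelNegBParamsFace
import Summits.CriticalPhenomena.PercolationContinuityZ3.Theorems.Transplant.SkelNegBParamsRootVals
import HarnessLib

/-!
# N1 params, chain of record `NegB`, part FaceBand: THE CONTACT BAND FITS THE TRANSVERSE HABITAT — `kFF₂ ≤ 2r + 5Rl + 15`, hence
# `kFF₂ + 6u + 9 ≤ 5r` (hp-8 g33's FX5/FX6 floor `kE + 6κ⊥ + k₀ + 6 ≤ 5r⊥`, kE := kFF₂, k₀ ≤ 3) and `2·kFF₂ + 2u + 7 ≤ 5r` (the (L-F3) reach floor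
# `2kE + 2κ⊥ + k₀ + 4 ≤ 5r⊥`: FY5/FY6 ∧ FL3/FL4 need `wc + 2κ⊥ ≤ fw = 5r⊥ − 4 − k₀ − wc`), at `g := gT`, every `Rl ≤ RA′` (stmt-g15 2026-08-22; hp-8 00:5xZ)
Part Face's `hkF_R` chain made linear: from `x·D·kF ≤ M(aw + Rl + 1) + y(Rl+2)D + xD − 1`, `M·aw ≤ (x(2r+1) + y)·D + M − 1`, `y ≤ 3x`, `M ≤ 2xD` one gets
**`kFF₂ ≤ 2r + 5Rl + 15`** (both axes, any `Rl`); with `r = 40u` (`KS.units_eq`) and `r ≥ K(6RA′+11) ≥ 40(6Rl+11)` (`KS.r_geT`) the two habitat floors follow.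
builds on p205010 (kernel theorem, internal audit signed; external expert review pending) — nothing in this file uses p205010; NOTHING is claimed about
the node `SamePDropOfSkeletonNeg₁` (OPEN; its (F) column is blocked on the named LEVEL-0 statement `hlin`, lead g7 RULING E2).
Lane `prim-bschramm-*`, seat `prim-bschramm-stmt` (gen 15); helper file (`--supports stmt-CriticalPhenomena-4575 --as helper`); ledger HOME/prim-bschramm-stmt/NEG-PARAMS.md.
* **`kFF₂_le_lin`**, **`hkE_R`**.
[cite: KozmaNitzan2024, §4 Lemma 10 Step IV (pp. 20–21); Lemma 12 (pp. 23–25)] [cite: MartineauTassion2017, §4.3]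
-/

noncomputable section

open scoped Classical

namespace Summit.CriticalPhenomena.PercolationContinuityZ3.Theorems.Transplant

namespace PlanarSkeletonNeg

namespace NegB

open Literature.Probability.Percolation Literature.Probability.LatticeModels SimpleGraph
open Literature.Probability.Percolation.KozmaNitzan.Cells (oth)
open SkelConc (Consts)
open Skelφ.StepI (DataN)
open Neg

section Band

variable (κ : Consts) {V : Type} [DecidableEq V] [Countable V] {G : SimpleGraph V} [G.LocallyFinite] (Φ : PlanarSkeletonNeg G) (t : V)
  (p : unitInterval) (D : DataN V) (f mk : ℕ) (gx : Neg.FSlot)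

/-- **The contact band half-width is linear in the cell radius**: `kFF₂ (prF) fcells Rl I ≤ 2·r_(oth I) + 5·Rl + 15` at `g := gT` (any `Rl`, both axes).
[cite: KozmaNitzan2024, §4 Lemma 10 Step IV] -/
theorem kFF₂_le_lin (hN : EqNumL κ Φ t p D (KS.gT mk gx κ Φ t p D) f) (hκ : (hL κ Φ t p D (KS.gT mk gx κ Φ t p D) f).natAbs ≤ 10 * nL κ Φ t p D (KS.gT mk gx κ Φ t p D) f)
    (Rl : ℕ) (I : Fin 2) :
    (prF κ Φ t p D (KS.gT mk gx κ Φ t p D) f).kFF₂ (fcells κ Φ t p D (KS.gT mk gx κ Φ t p D) f) Rl I ≤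
      2 * ((fcells κ Φ t p D (KS.gT mk gx κ Φ t p D) f).r (oth I) : ℤ) + 5 * Rl + 15 := by
  set pr := prF κ Φ t p D (KS.gT mk gx κ Φ t p D) f
  set P := fcells κ Φ t p D (KS.gT mk gx κ Φ t p D) f
  have hDpos := (prF_pos κ Φ t p D (KS.gT mk gx κ Φ t p D) f hN).2.2.2.2.2
  obtain ⟨hc₀, hc₁⟩ := prF_c_pos κ Φ t p D (KS.gT mk gx κ Φ t p D) f
  have hDd := prF_D κ Φ t p D (KS.gT mk gx κ Φ t p D) f
  have hx : 0 < pr.rdK I (pr.bOf I) := rdK_pos_R κ Φ t p D _ f hN I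
  have hM : 0 < pr.Mabs := pr.Mabs_pos hc₀ hc₁ hDd hDpos
  have hy : pr.rdN I (pr.bOf I) ≤ pr.rdK I (pr.bOf I) * 3 := rdN_le_three_rdK κ Φ t p D _ f hN I (eleven_le_s_T κ Φ t p D f mk gx hN hκ I)
  have hM2 : pr.Mabs ≤ 2 * pr.rdK I (pr.bOf I) * pr.D := Mabs_le_two_rdK_D κ Φ t p D _ f hN I
  set aw := pr.awF₂ P (I, true) with haw
  have haw' : pr.Mabs * aw ≤ pr.awNum P (I, true) + pr.Mabs - 1 := by
    rw [haw]; unfold Skelφ.FinePrm.awF₂; exact Int.mul_ediv_self_le hM.ne'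
  rw [awNum_eq] at haw'
  set x := pr.rdK I (pr.bOf I)
  set y := pr.rdN I (pr.bOf I)
  set r := (P.r (oth I) : ℤ)
  have hxD : 0 < x * pr.D := mul_pos hx hDpos
  set q := pr.kFF₂ P Rl I with hq
  have hq' : x * pr.D * q ≤ pr.Mabs * (aw + Rl + 1) + y * (Rl + 2) * pr.D + x * pr.D - 1 := by
    rw [hq]; unfold Skelφ.FinePrm.kFF₂; exact Int.mul_ediv_self_le hxD.ne'
  have hR0 : (0 : ℤ) ≤ Rl := by positivity
  have hr0 : (0 : ℤ) ≤ r := by positivity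
  have hyR : y * ((Rl : ℤ) + 2) * pr.D ≤ x * 3 * ((Rl : ℤ) + 2) * pr.D := by
    have : 0 ≤ ((Rl : ℤ) + 2) * pr.D := by positivity
    nlinarith
  have hMR : pr.Mabs * ((Rl : ℤ) + 1) ≤ 2 * x * pr.D * ((Rl : ℤ) + 1) := mul_le_mul_of_nonneg_right hM2 (by positivity)
  have hyD : y * pr.D ≤ 3 * x * pr.D := by nlinarith
  -- `xD·q ≤ M·aw + M(Rl+1) + y(Rl+2)D + xD − 1 ≤ (x(2r+1)+y)D + M − 1 + … ≤ xD·(2r + 5Rl + 15) − 1`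
  have hlin : x * pr.D * q ≤ x * pr.D * (2 * r + 5 * Rl + 15) - 1 := by
    have e1 : pr.Mabs * (aw + Rl + 1) = pr.Mabs * aw + pr.Mabs * ((Rl : ℤ) + 1) := by ring
    nlinarith
  have hle : x * pr.D * q < x * pr.D * (2 * r + 5 * Rl + 15 + 1) := by nlinarith
  have := lt_of_mul_lt_mul_left hle hxD.le
  linarith

/-- **THE TWO HABITAT FLOORS OF THE CONTACT BAND** at `g := gT`, every `Rl ≤ RA′`, both axes (`u_J := r_J/40`, `KS.units_eq`):
`kFF₂ + 6·u_J + 9 ≤ 5·r_J` (hp-8's FX5/FX6 floor with `k₀ ≤ 3`) and `2·kFF₂ + 2·u_J + 7 ≤ 5·r_J` (the tangential reach `wc + 2κ⊥ ≤ fw`, (L-F3)).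
[cite: KozmaNitzan2024, §4 Lemma 12 (pp. 23–25)] -/
theorem hkE_R (hN : EqNumL κ Φ t p D (KS.gT mk gx κ Φ t p D) f) (hκ : (hL κ Φ t p D (KS.gT mk gx κ Φ t p D) f).natAbs ≤ 10 * nL κ Φ t p D (KS.gT mk gx κ Φ t p D) f)
    {Rl : ℕ} (hRl : Rl ≤ KS.RA' κ Φ t p D mk) (I : Fin 2) :
    (prF κ Φ t p D (KS.gT mk gx κ Φ t p D) f).kFF₂ (fcells κ Φ t p D (KS.gT mk gx κ Φ t p D) f) Rl I +
          6 * (((fcells κ Φ t p D (KS.gT mk gx κ Φ t p D) f).r (oth I) : ℤ) / 40) + 9 ≤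
        5 * ((fcells κ Φ t p D (KS.gT mk gx κ Φ t p D) f).r (oth I) : ℤ) ∧
      2 * (prF κ Φ t p D (KS.gT mk gx κ Φ t p D) f).kFF₂ (fcells κ Φ t p D (KS.gT mk gx κ Φ t p D) f) Rl I +
          2 * (((fcells κ Φ t p D (KS.gT mk gx κ Φ t p D) f).r (oth I) : ℤ) / 40) + 7 ≤
        5 * ((fcells κ Φ t p D (KS.gT mk gx κ Φ t p D) f).r (oth I) : ℤ) := by
  have hq := kFF₂_le_lin κ Φ t p D f mk gx hN hκ Rl I
  -- `r_J = 40·u_J` exactly and `r_J ≥ K(6RA′+11)`, `K ≥ 40`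
  obtain ⟨e0, e1, hr0, hr1, -, -, hu0, hu1⟩ := KS.units_eq κ Φ t p D (KS.gT mk gx κ Φ t p D) f
  obtain ⟨g0, g1⟩ := KS.r_geT κ Φ t p D mk gx f hN hκ
  have hK : (40 : ℤ) ≤ Neg.K κ := by exact_mod_cast (Neg.forty_le_K κ).1
  have hRl' : (Rl : ℤ) ≤ KS.RA' κ Φ t p D mk := by exact_mod_cast hRl
  have hR0 : (0 : ℤ) ≤ (KS.RA' κ Φ t p D mk : ℤ) := by positivity
  set q := (prF κ Φ t p D (KS.gT mk gx κ Φ t p D) f).kFF₂ (fcells κ Φ t p D (KS.gT mk gx κ Φ t p D) f) Rl I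
  obtain rfl | rfl : I = 0 ∨ I = 1 := by fin_cases I <;> simp
  · rw [show oth (0 : Fin 2) = 1 from rfl] at hq ⊢
    rw [hr1, show (40 : ℤ) * KS.u₁ κ Φ t p D (KS.gT mk gx κ Φ t p D) f / 40 = KS.u₁ κ Φ t p D (KS.gT mk gx κ Φ t p D) f by omega]
    rw [hr1] at g1
    have hu : 6 * (KS.RA' κ Φ t p D mk : ℤ) + 11 ≤ KS.u₁ κ Φ t p D (KS.gT mk gx κ Φ t p D) f := by nlinarith
    constructor <;> nlinarith
  · rw [show oth (1 : Fin 2) = 0 from rfl] at hq ⊢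
    rw [hr0, show (40 : ℤ) * KS.u₀ κ Φ t p D (KS.gT mk gx κ Φ t p D) f / 40 = KS.u₀ κ Φ t p D (KS.gT mk gx κ Φ t p D) f by omega]
    rw [hr0] at g0
    have hu : 6 * (KS.RA' κ Φ t p D mk : ℤ) + 11 ≤ KS.u₀ κ Φ t p D (KS.gT mk gx κ Φ t p D) f := by nlinarith
    constructor <;> nlinarith

end Band

end NegB

end PlanarSkeletonNeg

end Summit.CriticalPhenomena.PercolationContinuityZ3.Theorems.Transplant

end
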